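import Mathlib.LinearAlgebra.Matrix.Kronecker
import Mathlib.LinearAlgebra.Matrix.GeneralLinearGroup.Defs
import Mathlib.NumberTheory.Zsqrtd.Basic
import Mathlib.FieldTheory.IsAlgClosed.Basic
import Mathlib.Analysis.Complex.Polynomial.Basic
import Literature.Computability.AlgebraicComplexity.BorderRankCW
import HarnessLib

/-!
# Proof of CGLV Lemma 2.4: `T_{cw,2}^{⊠2} ≅ perm₃`, `T_{skewcw,2}^{⊠2} ≅ det₃`
(discharge of `CGLV2022_lemma24`), and of CGLV Thm. 4.1: `R_S(det₃) ≤ 18` (half of Thm. 1.3)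

Topic `Literature/Computability/AlgebraicComplexity`; sibling of `BorderRankCW.lean`, whose named
fact `CGLV2022_lemma24` (Conner–Gesmundo–Landsberg–Ventura, *Rank and border rank of Kronecker
powers of tensors and Strassen's laser method*, comput. complexity 31 (2022) = arXiv:1909.04785v2,
Lemma 2.4, proved in §3.2) is PROVED here: `CGLV2022_lemma24_holds`.

## The proof (CGLV §3.2, made explicit)

The printed proof (§3.2) exhibits changes of basis of `ℂ³` after which `T_{skewcw,2}` becomes the
skew-symmetric tensor `a₀ ∧ a₁ ∧ a₂` ("`b̃₀ := -b₀`, `c̃₁ := c₂`, `c̃₂ := -c₁`") and `T_{cw,2}`, the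
symmetric tensor of `a₀(a₁² + a₂²)`, becomes (a multiple of) the symmetric tensor of the
square-free monomial `a₀a₁a₂`; it then concludes by comparing stabilisers (`det₃`, `perm₃` are
characterised by their stabilisers, Rem. 3.3). We replace the stabiliser argument by the direct
computation it abbreviates:

* `cglv_exists_basis_skewCwTensor_one` — with `B = diag(-1,1,1)` and `C : c₁ ↦ c₂, c₂ ↦ -c₁`,
  `(1, B, C) · T_{skewcw,2} = ∑_{σ ∈ 𝔖₃} sgn(σ) a_{σ(0)} ⊗ b_{σ(1)} ⊗ c_{σ(2)}` (entries `ε_{ijk}`);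
* `cglv_exists_basis_cwTensor_two` — with `A : a₁ ↦ a₁ + a₂, a₂ ↦ -i(a₁ - a₂)` (over `ℂ`,
  `a₁² + a₂² = (a₁ + i a₂)(a₁ - i a₂)`), `(A, A, A) · T_{cw,2} = 2 ∑_{σ} a_{σ(0)} ⊗ b_{σ(1)} ⊗ c_{σ(2)}`
  (entries `2|ε_{ijk}|`);
* `cglv_act_kronecker_sq` — Kronecker-product matrices act factorwise on the reindexed Kronecker
  square, so `(λA ⊗ A, A ⊗ A, A ⊗ A) · T_{cw,2}^{⊠2}` has entries `4λ |ε_{i₁i₂i₃}| |ε_{j₁j₂j₃}|`, which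
  for `λ = 1/24` is `perm₃` as vendored (`(1/6) |ε| |ε|`), and `((1/6)·1 ⊗ 1, B ⊗ B, C ⊗ C) ·
  T_{skewcw,2}^{⊠2} = det₃` (`(1/6) ε ε`). All six `9 × 9` matrices have nonzero determinant
  (`det (X ⊗ Y) = det X ³ det Y ³`), giving the required `(g₁, g₂, g₃) ∈ GL₉(ℂ)³`.

## Theorem 1.3 = Theorem 4.1 ∧ Theorem 4.2 (Waring rank and border Waring rank of `det₃`)

`CGLV2022_thm13` (`R_S(det₃) ≤ 18 ∧ bR_S(det₃) ≤ 17`, Thm. 1.3) is, in the source, "a consequence of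
Theorem 4.1 and Theorem 4.2" (§4, p. 17; numbering of arXiv:1909.04785v2 throughout, as in
`BorderRankCW.lean`). The two halves are of very different nature and are separated here:

* **Thm. 4.1, `R_S(det₃) ≤ 18` — PROVED** (`waringRank_det3Tensor_le`, via
  `det3Tensor_mem_waringLESet`). The printed proof lists 18 linear forms `L₁, …, L₁₈` on
  `ℂ⁹ = ℂ³ ⊗ ℂ³` (as `3 × 3` coefficient matrices with entries in
  `{0, ±1, ±θ, ±θ̄, ±1/3, ±θ/3, ±θ̄/3}`, `θ = e^{2πi/6}`, `θ̄ = θ⁻¹`) "whose cubes add up to `det₃`";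
  "the equality can be verified by hand. A Macaulay2 file performing the calculation is available in
  Appendix B". That file (`Det3_Rank18.m2`) checks `∑_{j=1}^{18} L_j³ - 6·det(X) = 0`, i.e. the
  printed forms decompose `6·det(X)` (the display "`det₃ = ∑₁¹⁸ L_i³`" in the proof is off by this
  factor `6 = (6^{1/3})³`, harmless since Waring rank is invariant under rescaling over `ℂ`). We
  vendor `6·L_i` with coordinates in `ℤ[√-3] ∋ 6θ = 3 + 3√-3` (`cglvDet3Forms6`, in Mathlib's
  computable `ℤ√(-3)`), let the KERNEL verify the `9³ = 729` coordinates of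
  `∑_i (6L_i)^{⊗3} = 216 · ∑_{σ,τ} sgn(σ)sgn(τ) a ⊗ b ⊗ c` (`cglvDet3Forms6_sum_cubes`,
  `decide +kernel`, the Levi-Civita symbol through the table `leviCivita3Table`), push it to `ℂ`
  along a ring map `ℤ√(-3) → ℂ` (`Zsqrtd.lift` at a square root of `-3`) and rescale by a cube root
  `μ` of `1/1296 = (1/6)/6³` (both roots exist, `ℂ` being algebraically closed), obtaining
  `det₃ = ∑_{i<18} w_i ⊗ w_i ⊗ w_i` with `w_i = μ · φ(6L_i)` for the vendored normalisation
  `det₃ = (1/6) ∑_{σ,τ} sgn(σ)sgn(τ) a_{σ(1)τ(1)} ⊗ b_{σ(2)τ(2)} ⊗ c_{σ(3)τ(3)}`.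
* **Thm. 4.2, `bR_S(det₃) ≤ 17` — NAMED FACT** `CGLV2022_thm42`. The printed proof is a
  computer-algebra certificate: 17 forms `L_i(t)` in 44 parameters `z_1, …, z_44`, `z_j` the real
  cube root of an element `y_j` of the degree-27 number field `ℚ[y_*]` (`y_*` a real root of an
  explicit degree-27 integer polynomial; the `y_j` are polynomials of degree `≤ 26` in `y_*` with
  ~45-digit rational coefficients, file `yy_exps.m2` of Appendix C), and
  `t² det₃ + O(t³) = ∑_{i=1}^{17} L_i(t)³` reduces to 54 cubic equations in the `z_j`, verified by
  exact arithmetic in `ℚ[y_*]` (14 equations) or in a cubic extension `ℚ[y_*, u]` (40 equations) by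
  the Macaulay2 scripts of Appendix C (≈ 475 kB of certificate data). Following the tree's policy
  for large computer-assisted results (`Literature/Analysis/ValidatedNumerics/Certificate.lean`,
  "the named-hypothesis pattern") it is kept as a named fact; `CGLV2022_thm13_of_thm42` records that
  it is all that `CGLV2022_thm13` still needs (`CGLV2022_thm13_iff`), and
  `borderWaringRank_det3Tensor_le` is the unconditional `bR_S(det₃) ≤ 18`.

## References

* A. Conner, F. Gesmundo, J. M. Landsberg, E. Ventura, *Rank and border rank of Kronecker powers of
  tensors and Strassen's laser method*, comput. complexity 31 (2022) = arXiv:1909.04785v2,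
  Lemma 2.4 and its proof, §3.2; Thm. 1.3; §4 (p. 17): Thm. 4.1 and its proof (the 18 forms),
  Thm. 4.2 and its proof; Supplementary Material `http://fulges.github.io/code/CGLV/`, Appendices B
  (`Det3_Rank18.m2`) and C (`Det3_borderRank17.tar.gz`). [ConnerGesmundoLandsbergVentura2022]
-/

noncomputable section

open scoped BigOperators Matrix Kronecker

namespace Literature.Computability.AlgebraicComplexity

/-! ## Kronecker-product changes of basis act factorwise

The action of `(A, B, C) ∈ Mat₃(ℂ)³` on `t ∈ ℂ³ ⊗ ℂ³ ⊗ ℂ³` is written out as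
`((A,B,C)·t)_{ijk} = ∑_{i'j'k'} A_{ii'} B_{jj'} C_{kk'} t_{i'j'k'}` (`a_{i'} ↦ A a_{i'}`, the `i'`-th
column of `A`), and likewise on `ℂ⁹ ⊗ ℂ⁹ ⊗ ℂ⁹` with `ℂ⁹ = ℂ³ ⊗ ℂ³` indexed by `Fin 3 × Fin 3`,
literally the triple sum of `CGLV2022_lemma24`. The Lemma 2.4 part of this file declares no
definitions (the `det₃` part below declares the data `leviCivita3Table`, `cglvDet3Forms6` and the
named fact `CGLV2022_thm42`). -/

/-- Kronecker-product changes of basis act factorwise on the (reindexed) Kronecker square: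
`((A₁ ⊗ A₂, B₁ ⊗ B₂, C₁ ⊗ C₂) · t^{⊠2})_{(i₁,i₂)(j₁,j₂)(k₁,k₂)} =
((A₁,B₁,C₁)·t)_{i₁j₁k₁} · ((A₂,B₂,C₂)·t)_{i₂j₂k₂}`. [folklore] -/
theorem cglv_act_kronecker_sq (A₁ A₂ B₁ B₂ C₁ C₂ : Matrix (Fin 3) (Fin 3) ℂ)
    (t : Fin 3 → Fin 3 → Fin 3 → ℂ) (a b c : Fin 3 × Fin 3) :
    ∑ a', ∑ b', ∑ c', (A₁ ⊗ₖ A₂) a a' * (B₁ ⊗ₖ B₂) b b' * (C₁ ⊗ₖ C₂) c c' *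
        squareReindex (kroneckerPow t 2) a' b' c' =
      (∑ i', ∑ j', ∑ k', A₁ a.1 i' * B₁ b.1 j' * C₁ c.1 k' * t i' j' k') *
        ∑ i', ∑ j', ∑ k', A₂ a.2 i' * B₂ b.2 j' * C₂ c.2 k' * t i' j' k' := by
  simp only [squareReindex_kroneckerPow_two, Matrix.kroneckerMap_apply, Fintype.sum_prod_type,
    Finset.sum_mul_sum]
  refine Finset.sum_congr rfl fun _ _ => Finset.sum_congr rfl fun _ _ =>
    Finset.sum_congr rfl fun _ _ => Finset.sum_congr rfl fun _ _ =>
    Finset.sum_congr rfl fun _ _ => Finset.sum_congr rfl fun _ _ => by ring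

/-- Scalars pull out of the first slot of the `Mat₃(ℂ)³`-action: `(rA, B, C)·t = r ((A, B, C)·t)`.
[folklore] -/
theorem cglv_act_smul (r : ℂ) (A B C : Matrix (Fin 3) (Fin 3) ℂ)
    (t : Fin 3 → Fin 3 → Fin 3 → ℂ) (i j k : Fin 3) :
    ∑ i', ∑ j', ∑ k', (r • A) i i' * B j j' * C k k' * t i' j' k' =
      r * ∑ i', ∑ j', ∑ k', A i i' * B j j' * C k k' * t i' j' k' := by
  simp only [Matrix.smul_apply, smul_eq_mul, Finset.mul_sum]
  refine Finset.sum_congr rfl fun _ _ => Finset.sum_congr rfl fun _ _ =>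
    Finset.sum_congr rfl fun _ _ => by ring

/-! ## The two `3 × 3 × 3` changes of basis of CGLV §3.2 -/

/-- **CGLV §3.2, the `T_{cw,2}` half, in coordinates.** With the change of basis `A` of columns
`a₀ ↦ a₀`, `a₁ ↦ a₁ + a₂`, `a₂ ↦ -i a₁ + i a₂` (the printed `ã₁ := a₁ + a₂`, `ã₂ := a₁ - a₂`,
complexified so that `a₁² + a₂² = (a₁ + i a₂)(a₁ - i a₂)` splits; `det A = 2i`, and
`Aa₁ ⊗ Aa₁ + Aa₂ ⊗ Aa₂ = 2 (a₁ ⊗ a₂ + a₂ ⊗ a₁)`):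
`(A, A, A) · T_{cw,2} = 2 ∑_{σ ∈ 𝔖₃} a_{σ(0)} ⊗ b_{σ(1)} ⊗ c_{σ(2)}`, i.e. entries `2 |ε_{ijk}|`
(twice the polarisation of the square-free monomial `6 a₀a₁a₂`).
[cite: ConnerGesmundoLandsbergVentura2022, §3.2 (proof of Lemma 2.4)] -/
theorem cglv_exists_basis_cwTensor_two :
    ∃ A : Matrix (Fin 3) (Fin 3) ℂ, A.det ≠ 0 ∧ ∀ i j k : Fin 3,
      ∑ i', ∑ j', ∑ k', A i i' * A j j' * A k k' * cwTensor ℂ 2 i' j' k' =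
        2 * ((|leviCivita3 i j k| : ℤ) : ℂ) := by
  refine ⟨!![1, 0, 0; 0, 1, -Complex.I; 0, 1, Complex.I], ?_, ?_⟩
  · have h : Matrix.det !![(1 : ℂ), 0, 0; 0, 1, -Complex.I; 0, 1, Complex.I] = 2 * Complex.I := by
      simp [Matrix.det_fin_three]; ring
    rw [h]
    simp [Complex.I_ne_zero]
  · intro i j k
    fin_cases i <;> fin_cases j <;> fin_cases k <;>
      simp [Fin.sum_univ_three, cwTensor, leviCivita3, Matrix.det_fin_three] <;> ring

/-- **CGLV §3.2, the `T_{skewcw,2}` half, in coordinates.** With `B = diag(-1, 1, 1)` (the printed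
`b̃₀ := -b₀`) and `C` of columns `c₀ ↦ c₀`, `c₁ ↦ c₂`, `c₂ ↦ -c₁` (the printed `c̃₁ := c₂`,
`c̃₂ := -c₁`): `(1, B, C) · T_{skewcw,2} = ∑_{σ ∈ 𝔖₃} sgn(σ) a_{σ(0)} ⊗ b_{σ(1)} ⊗ c_{σ(2)}
= a₀ ∧ a₁ ∧ a₂`, i.e. entries `ε_{ijk}`.
[cite: ConnerGesmundoLandsbergVentura2022, §3.2 (proof of Lemma 2.4)] -/
theorem cglv_exists_basis_skewCwTensor_one :
    ∃ B C : Matrix (Fin 3) (Fin 3) ℂ, B.det ≠ 0 ∧ C.det ≠ 0 ∧ ∀ i j k : Fin 3,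
      ∑ i', ∑ j', ∑ k', (1 : Matrix (Fin 3) (Fin 3) ℂ) i i' * B j j' * C k k' *
        skewCwTensor ℂ 1 i' j' k' = (leviCivita3 i j k : ℂ) := by
  refine ⟨!![-1, 0, 0; 0, 1, 0; 0, 0, 1], !![1, 0, 0; 0, 0, -1; 0, 1, 0], ?_, ?_, ?_⟩
  · simp [Matrix.det_fin_three]
  · simp [Matrix.det_fin_three]
  · intro i j k
    fin_cases i <;> fin_cases j <;> fin_cases k <;>
      simp [Fin.sum_univ_three, skewCwTensor, leviCivita3, Matrix.det_fin_three, Matrix.one_apply]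

/-! ## Lemma 2.4 -/

/-- **CGLV Lemma 2.4 holds**: `T_{cw,2}^{⊠2} ≅ perm₃` via
`g = ((1/24)A ⊗ A, A ⊗ A, A ⊗ A) ∈ GL₉(ℂ)³`, and `T_{skewcw,2}^{⊠2} ≅ det₃` via
`g = ((1/6)1 ⊗ 1, B ⊗ B, C ⊗ C) ∈ GL₉(ℂ)³`, where `A`, `B`, `C` are the changes of basis of
CGLV §3.2 (`cglv_exists_basis_cwTensor_two`, `cglv_exists_basis_skewCwTensor_one`); the factors
`1/24`, `1/6` match the normalisation `(1/6) ∑_{σ,τ}` of the vendored `perm₃`, `det₃`, and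
`det (X ⊗ Y) = det X ³ · det Y ³ ≠ 0`.
[cite: ConnerGesmundoLandsbergVentura2022, Lemma 2.4 (proof: §3.2)] -/
theorem CGLV2022_lemma24_holds : CGLV2022_lemma24 := by
  obtain ⟨A, hAdet, hA⟩ := cglv_exists_basis_cwTensor_two
  obtain ⟨B, C, hBdet, hCdet, hBC⟩ := cglv_exists_basis_skewCwTensor_one
  have h3 : ∀ X Y : Matrix (Fin 3) (Fin 3) ℂ, X.det ≠ 0 → Y.det ≠ 0 → (X ⊗ₖ Y).det ≠ 0 := by
    intro X Y hX hY
    rw [Matrix.det_kronecker]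
    exact mul_ne_zero (pow_ne_zero _ hX) (pow_ne_zero _ hY)
  have hs : ∀ (r : ℂ) (X : Matrix (Fin 3) (Fin 3) ℂ), r ≠ 0 → X.det ≠ 0 → (r • X).det ≠ 0 := by
    intro r X hr hX
    rw [Matrix.det_smul]
    exact mul_ne_zero (pow_ne_zero _ hr) hX
  have h1 : (1 : Matrix (Fin 3) (Fin 3) ℂ).det ≠ 0 := by simp
  refine ⟨⟨(Matrix.GeneralLinearGroup.mkOfDetNeZero _
        (h3 _ _ (hs (1 / 24) A (by norm_num) hAdet) hAdet),
      Matrix.GeneralLinearGroup.mkOfDetNeZero _ (h3 A A hAdet hAdet),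
      Matrix.GeneralLinearGroup.mkOfDetNeZero _ (h3 A A hAdet hAdet)), ?_⟩,
    ⟨(Matrix.GeneralLinearGroup.mkOfDetNeZero _ (h3 _ _ (hs (1 / 6) 1 (by norm_num) h1) h1),
      Matrix.GeneralLinearGroup.mkOfDetNeZero _ (h3 B B hBdet hBdet),
      Matrix.GeneralLinearGroup.mkOfDetNeZero _ (h3 C C hCdet hCdet)), ?_⟩⟩
  · funext a b c
    simp only [Matrix.GeneralLinearGroup.val_mkOfDetNeZero]
    rw [cglv_act_kronecker_sq, cglv_act_smul, hA, hA]
    simp only [perm3Tensor, Int.cast_mul]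
    ring
  · funext a b c
    simp only [Matrix.GeneralLinearGroup.val_mkOfDetNeZero]
    rw [cglv_act_kronecker_sq, cglv_act_smul, hBC, hBC]
    simp only [det3Tensor, Int.cast_mul]
    ring

/-! ## Theorem 4.1: `R_S(det₃) ≤ 18` (the explicit 18-term Waring decomposition)

The data of the printed proof, a kernel verification of the identity it asserts, and its transfer
to `ℂ`. -/

/-- The Levi-Civita symbol on `{0,1,2}` as an explicit table (kernel-evaluable companion of
`leviCivita3`, see `leviCivita3_eq_table`): `ε₀₁₂ = ε₁₂₀ = ε₂₀₁ = 1`, `ε₀₂₁ = ε₂₁₀ = ε₁₀₂ = -1`,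
`0` otherwise. [folklore] -/
def leviCivita3Table : Fin 3 → Fin 3 → Fin 3 → ℤ :=
  ![![![0, 0, 0], ![0, 0, 1], ![0, -1, 0]],
    ![![0, 0, -1], ![0, 0, 0], ![1, 0, 0]],
    ![![0, 1, 0], ![-1, 0, 0], ![0, 0, 0]]]

/-- `leviCivita3` (a `3 × 3` determinant of standard basis vectors) agrees with the table.
[folklore] -/
theorem leviCivita3_eq_table (i j k : Fin 3) : leviCivita3 i j k = leviCivita3Table i j k := by
  fin_cases i <;> fin_cases j <;> fin_cases k <;>
    simp [leviCivita3, leviCivita3Table, Matrix.det_fin_three]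

/-- **The 18 linear forms of CGLV Thm. 4.1, times `6`, over `ℤ[√-3]`.** `cglvDet3Forms6 i r c` is
`6 · (L_{i+1})_{rc}`, where `L₁, …, L₁₈` are the printed `3 × 3` coefficient matrices of the proof of
Thm. 4.1 ("the matrix `(ζ_{ij})` represents the linear form `∑ ζ_{ij} x_{ij}`" on `ℂ⁹ = ℂ³ ⊗ ℂ³`),
written in `ℤ√(-3)` via `θ = e^{2πi/6} = (1 + √-3)/2`: `6 = ⟨6,0⟩`, `6θ = ⟨3,3⟩`, `6θ̄ = ⟨3,-3⟩`,
`6·(1/3) = ⟨2,0⟩`, `2θ = ⟨1,1⟩`, `2θ̄ = ⟨1,-1⟩`. E.g. `L₁ = diag(-θ, -1/3, θ̄)`,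
`L₁₈ = θ x₀₂ - (θ̄/3) x₁₁ + x₂₀`.
[cite: ConnerGesmundoLandsbergVentura2022, Thm. 4.1 (proof, the forms L₁–L₁₈)] -/
def cglvDet3Forms6 : Fin 18 → Fin 3 → Fin 3 → ℤ√(-3) :=
  ![![![⟨-3, -3⟩, ⟨0, 0⟩, ⟨0, 0⟩], ![⟨0, 0⟩, ⟨-2, 0⟩, ⟨0, 0⟩], ![⟨0, 0⟩, ⟨0, 0⟩, ⟨3, -3⟩]],
    ![![⟨-3, 3⟩, ⟨0, 0⟩, ⟨0, 0⟩], ![⟨0, 0⟩, ⟨-2, 0⟩, ⟨0, 0⟩], ![⟨0, 0⟩, ⟨0, 0⟩, ⟨3, 3⟩]],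
    ![![⟨-3, 3⟩, ⟨0, 0⟩, ⟨0, 0⟩], ![⟨0, 0⟩, ⟨1, -1⟩, ⟨0, 0⟩], ![⟨0, 0⟩, ⟨0, 0⟩, ⟨3, -3⟩]],
    ![![⟨-6, 0⟩, ⟨0, 0⟩, ⟨0, 0⟩], ![⟨0, 0⟩, ⟨0, 0⟩, ⟨-3, 3⟩], ![⟨0, 0⟩, ⟨-1, -1⟩, ⟨0, 0⟩]],
    ![![⟨3, -3⟩, ⟨0, 0⟩, ⟨0, 0⟩], ![⟨0, 0⟩, ⟨0, 0⟩, ⟨6, 0⟩], ![⟨0, 0⟩, ⟨-1, -1⟩, ⟨0, 0⟩]],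
    ![![⟨3, 3⟩, ⟨0, 0⟩, ⟨0, 0⟩], ![⟨0, 0⟩, ⟨0, 0⟩, ⟨-3, -3⟩], ![⟨0, 0⟩, ⟨-1, -1⟩, ⟨0, 0⟩]],
    ![![⟨0, 0⟩, ⟨1, -1⟩, ⟨0, 0⟩], ![⟨-3, -3⟩, ⟨0, 0⟩, ⟨0, 0⟩], ![⟨0, 0⟩, ⟨0, 0⟩, ⟨6, 0⟩]],
    ![![⟨0, 0⟩, ⟨1, -1⟩, ⟨0, 0⟩], ![⟨-3, 3⟩, ⟨0, 0⟩, ⟨0, 0⟩], ![⟨0, 0⟩, ⟨0, 0⟩, ⟨-3, 3⟩]],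
    ![![⟨0, 0⟩, ⟨1, 1⟩, ⟨0, 0⟩], ![⟨-3, 3⟩, ⟨0, 0⟩, ⟨0, 0⟩], ![⟨0, 0⟩, ⟨0, 0⟩, ⟨6, 0⟩]],
    ![![⟨0, 0⟩, ⟨-1, -1⟩, ⟨0, 0⟩], ![⟨0, 0⟩, ⟨0, 0⟩, ⟨3, -3⟩], ![⟨-6, 0⟩, ⟨0, 0⟩, ⟨0, 0⟩]],
    ![![⟨0, 0⟩, ⟨-1, 1⟩, ⟨0, 0⟩], ![⟨0, 0⟩, ⟨0, 0⟩, ⟨3, 3⟩], ![⟨-6, 0⟩, ⟨0, 0⟩, ⟨0, 0⟩]],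
    ![![⟨0, 0⟩, ⟨2, 0⟩, ⟨0, 0⟩], ![⟨0, 0⟩, ⟨0, 0⟩, ⟨-6, 0⟩], ![⟨-6, 0⟩, ⟨0, 0⟩, ⟨0, 0⟩]],
    ![![⟨0, 0⟩, ⟨0, 0⟩, ⟨6, 0⟩], ![⟨-6, 0⟩, ⟨0, 0⟩, ⟨0, 0⟩], ![⟨0, 0⟩, ⟨-2, 0⟩, ⟨0, 0⟩]],
    ![![⟨0, 0⟩, ⟨0, 0⟩, ⟨6, 0⟩], ![⟨3, -3⟩, ⟨0, 0⟩, ⟨0, 0⟩], ![⟨0, 0⟩, ⟨1, 1⟩, ⟨0, 0⟩]],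
    ![![⟨0, 0⟩, ⟨0, 0⟩, ⟨6, 0⟩], ![⟨3, 3⟩, ⟨0, 0⟩, ⟨0, 0⟩], ![⟨0, 0⟩, ⟨1, -1⟩, ⟨0, 0⟩]],
    ![![⟨0, 0⟩, ⟨0, 0⟩, ⟨3, -3⟩], ![⟨0, 0⟩, ⟨-1, -1⟩, ⟨0, 0⟩], ![⟨6, 0⟩, ⟨0, 0⟩, ⟨0, 0⟩]],
    ![![⟨0, 0⟩, ⟨0, 0⟩, ⟨3, -3⟩], ![⟨0, 0⟩, ⟨-1, 1⟩, ⟨0, 0⟩], ![⟨-3, 3⟩, ⟨0, 0⟩, ⟨0, 0⟩]],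
    ![![⟨0, 0⟩, ⟨0, 0⟩, ⟨3, 3⟩], ![⟨0, 0⟩, ⟨-1, 1⟩, ⟨0, 0⟩], ![⟨6, 0⟩, ⟨0, 0⟩, ⟨0, 0⟩]]]

/-- **Kernel verification of the rank-18 identity** (the content of Appendix B's Macaulay2 check
`∑_{j=1}^{18} L_j³ - 6 det(X) = 0`, as a tensor identity in `ℤ[√-3]`): for all coordinates
`a, b, c ∈ {0,1,2}²`, `∑_{i<18} (6L_i)_a (6L_i)_b (6L_i)_c = 216 · ε_{a₁b₁c₁} ε_{a₂b₂c₂}`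
(`= 6³ · 6 · (det₃)_{abc}` for `det₃ = (1/6) ∑ sgn(σ)sgn(τ) a ⊗ b ⊗ c`). All `729` entries are
evaluated by the kernel (`decide +kernel`).
[cite: ConnerGesmundoLandsbergVentura2022, Thm. 4.1 (proof) and Appendix B] -/
theorem cglvDet3Forms6_sum_cubes : ∀ a b c : Fin 3 × Fin 3,
    (∑ i : Fin 18, cglvDet3Forms6 i a.1 a.2 * cglvDet3Forms6 i b.1 b.2 * cglvDet3Forms6 i c.1 c.2) =
      ((216 * (leviCivita3Table a.1 b.1 c.1 * leviCivita3Table a.2 b.2 c.2) : ℤ) : ℤ√(-3)) := by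
  decide +kernel

/-- **`det₃` is a sum of 18 cubes**: `det₃ ∈ {∑_{i<18} w_i ⊗ w_i ⊗ w_i}`. From
`cglvDet3Forms6_sum_cubes` pushed along a ring map `φ : ℤ[√-3] → ℂ` (`√-3 ↦ r`, `r² = -3`) and
rescaled: `w_i := μ · φ(6L_i)` with `μ³ = 1/1296`, so that
`∑_i w_i ⊗ w_i ⊗ w_i = μ³ · 216 · (ε ⊗ ε) = (1/6) ε ⊗ ε = det₃`.
[cite: ConnerGesmundoLandsbergVentura2022, Thm. 4.1] -/
theorem det3Tensor_mem_waringLESet : det3Tensor ∈ waringLESet (Fin 3 × Fin 3) ℂ 18 := by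
  obtain ⟨r, hr⟩ : ∃ r : ℂ, r ^ 2 = -3 := IsAlgClosed.exists_pow_nat_eq _ (by norm_num)
  obtain ⟨μ, hμ⟩ : ∃ μ : ℂ, μ ^ 3 = 1 / 1296 := IsAlgClosed.exists_pow_nat_eq _ (by norm_num)
  let φ : ℤ√(-3) →+* ℂ := Zsqrtd.lift ⟨r, by rw [← pow_two, hr]; norm_num⟩
  refine ⟨fun i a => μ * φ (cglvDet3Forms6 i a.1 a.2), ?_⟩
  funext a b c
  simp only [Finset.sum_apply, triad_apply]
  have key := congrArg φ (cglvDet3Forms6_sum_cubes a b c)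
  rw [map_sum, map_intCast] at key
  push_cast at key
  simp only [map_mul] at key
  calc det3Tensor a b c
      = μ ^ 3 * (216 * ((leviCivita3Table a.1 b.1 c.1 : ℂ) * (leviCivita3Table a.2 b.2 c.2 : ℂ))) := by
        simp only [det3Tensor, leviCivita3_eq_table, hμ, Int.cast_mul]; ring
    _ = μ ^ 3 * ∑ i, φ (cglvDet3Forms6 i a.1 a.2) * φ (cglvDet3Forms6 i b.1 b.2) *
          φ (cglvDet3Forms6 i c.1 c.2) := by rw [key]
    _ = ∑ i, μ * φ (cglvDet3Forms6 i a.1 a.2) * (μ * φ (cglvDet3Forms6 i b.1 b.2)) *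
          (μ * φ (cglvDet3Forms6 i c.1 c.2)) := by
        rw [Finset.mul_sum]
        exact Finset.sum_congr rfl fun i _ => by ring

/-- **CGLV Thm. 4.1** (first half of Thm. 1.3): the Waring rank of the `3 × 3` determinant, as a
symmetric tensor in `ℂ⁹ ⊗ ℂ⁹ ⊗ ℂ⁹`, is at most `18`: `R_S(det₃) ≤ 18`.
[cite: ConnerGesmundoLandsbergVentura2022, Thm. 4.1] -/
theorem waringRank_det3Tensor_le : waringRank det3Tensor ≤ 18 :=
  waringRank_le_of_mem det3Tensor_mem_waringLESet

/-- Unconditionally, `bR_S(det₃) ≤ 18` (from `bR_S ≤ R_S ≤ 18`; the source's `17` is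
`CGLV2022_thm42`). [cite: ConnerGesmundoLandsbergVentura2022, Thm. 4.1] -/
theorem borderWaringRank_det3Tensor_le : borderWaringRank det3Tensor ≤ 18 :=
  (borderWaringRank_le_waringRank ⟨18, det3Tensor_mem_waringLESet⟩).trans waringRank_det3Tensor_le

/-! ## Theorem 4.2 (named fact) and the reduction of Theorem 1.3 to it -/

/-- **CGLV Thm. 4.2** (second half of Thm. 1.3; NAMED FACT): the border Waring rank of the `3 × 3`
determinant is at most `17`, `bR_S(det₃) ≤ 17` — an equality by Conner–Harper–Landsberg 2019
(`bR(det₃) = 17`), not vendored. The printed proof is a computer-algebra certificate: 17 explicit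
forms `L₁(t), …, L₁₇(t)` whose 44 coefficients `z_j` are the real cube roots of elements `y_j` of the
number field `ℚ[y_*]` of degree 27 (`y_*` a real root of
`x²⁷ - 2x²⁶ + 17x²⁵ - ⋯ + 1146880x - 520192`), with `t² det₃ + O(t³) = ∑_{i=1}^{17} L_i(t)³`
reduced to 54 cubic equations in the `z_j`, each verified by exact arithmetic in `ℚ[y_*]` or a cubic
extension `ℚ[y_*, u]` (Macaulay2, Supplementary Material Appendix C); kept as a named fact per the
tree's policy for large computer-assisted certificates. Numbering of arXiv:1909.04785v2. Users take
`(h : CGLV2022_thm42)`. [cite: ConnerGesmundoLandsbergVentura2022, Thm. 4.2] -/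
def CGLV2022_thm42 : Prop :=
  borderWaringRank det3Tensor ≤ 17

/-- Thm. 1.3 as vendored (`CGLV2022_thm13`) is literally Thm. 4.1 ∧ Thm. 4.2.
[cite: ConnerGesmundoLandsbergVentura2022, Thm. 1.3 (= Thm. 4.1 + Thm. 4.2, §4)] -/
theorem CGLV2022_thm13_iff :
    CGLV2022_thm13 ↔ waringRank det3Tensor ≤ 18 ∧ CGLV2022_thm42 :=
  Iff.rfl

/-- **Thm. 1.3 from Thm. 4.2**: with Thm. 4.1 proved (`waringRank_det3Tensor_le`), the named fact
`CGLV2022_thm42` is all that `CGLV2022_thm13` still depends on (conversely, Thm. 1.3 contains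
Thm. 4.2 as its second conjunct, `(h : CGLV2022_thm13).2 : CGLV2022_thm42`; cf.
`CGLV2022_thm13_iff`).
[cite: ConnerGesmundoLandsbergVentura2022, Thm. 1.3 (= Thm. 4.1 + Thm. 4.2, §4)] -/
theorem CGLV2022_thm13_of_thm42 (h : CGLV2022_thm42) : CGLV2022_thm13 :=
  ⟨waringRank_det3Tensor_le, h⟩

end Literature.Computability.AlgebraicComplexity

end
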